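import Mathlib.Analysis.SpecialFunctions.SmoothTransition
import Mathlib.Analysis.SpecialFunctions.Gaussian.FourierTransform
import Mathlib.Analysis.SpecialFunctions.Exponential
import HarnessLib

/-!
# Gaussian annulus arithmetic in `ℝ⁴` — pointwise and elementary estimates (I)

Helper file for the stub `stub_coneAnnulusArithmetic` of line `ancient-sphere-rigidity`
(crux `EntropyRung.SubcylindricalRecognition`, stmt-SmoothPoincare4-10869).

The stub is the purely real-analytic heart of the cone-point exclusion: with the profile
`w(s) = e^{-s/8τ} cut(s)`, `cut(s) = T(s/(2ε²) - 1) · T(3 - 4s/r'²)` (`T = Real.smoothTransition`,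
so `cut = 1` on `[4ε², r'²/2]` and `cut = 0` off `(2ε², 3r'²/4)`), the quantities
`I₀ = ∫ w²`, `I₁ = ∫ 16 s w'²`, `I₂ = ∫ -w² log w²` over the annulus `{ε < |y| < r'} ⊂ ℝ⁴`
(`s = |y|²`) satisfy `I₀ ≈ 16π²τ²`, `τ I₁ ≈ I₂ ≈ 2 · 16π²τ²` with errors controlled by
`ε²/τ` and `τ/r'²`.

This file contains the first, POINTWISE, half of the argument (no measure theory):
* facts on `T = Real.smoothTransition`: its derivative vanishes off `[0, 1]` and is bounded;
* the cutoff: `cut = 1` on the bulk, `cut = 0` near `0` and near `r'²`, `0 ≤ cut ≤ 1`;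
* the derivative of the profile (`hasDerivAt_profile`, product and chain rules);
* elementary exponential inequalities (`h s e^{-as} ≤ e^{-(a-h)s} - e^{-as}`, `uⁿ e^{-u} ≤ n!`,
  and the resulting decay bounds `e^{-R/16τ} ≤ 16τ/R`, `R e^{-R/8τ} ≤ 128τ²/R`,
  `R³ e^{-R/8τ} ≤ 98304 τ⁴/R` used for the outer shell);
* pointwise bounds for `w²` from above and below and for `-w² log w²`, all dominated by
  Gaussians `e^{-a s}` so that the integrated versions only need `∫_{ℝ⁴} e^{-a|y|²} dy = π²/a²`.

The gradient density `16 s w'²` and the integration are in the companion files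
`…ConeAnnulusArithmeticAux2.lean`, `…ConeAnnulusArithmetic.lean`.
All statements are [folklore]; no named facts are used.
-/

-- the prescribed namespace `Summit.<P>.<Sub>.…` duplicates `SmoothPoincare4` (P = Sub)
set_option linter.dupNamespace false

noncomputable section

open scoped Topology
open Set Real

namespace Summit.SmoothPoincare4.SmoothPoincare4.Theorems.SubcylindricalRecognition.AncientSphereRigidity

namespace ConeAnnulus

/-! ## The smooth transition `T` -/

/-- `T' x = 0` for `x > 1` (`T ≡ 1` on `[1, ∞)`). [folklore] -/
theorem deriv_smoothTransition_of_one_lt {x : ℝ} (hx : 1 < x) :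
    deriv smoothTransition x = 0 := by
  have h : smoothTransition =ᶠ[𝓝 x] fun _ ↦ (1 : ℝ) := by
    filter_upwards [Ioi_mem_nhds hx] with y hy
    exact smoothTransition.one_of_one_le (le_of_lt hy)
  rw [h.deriv_eq, deriv_const]

/-- `T' x = 0` for `x < 0` (`T ≡ 0` on `(-∞, 0]`). [folklore] -/
theorem deriv_smoothTransition_of_neg {x : ℝ} (hx : x < 0) :
    deriv smoothTransition x = 0 := by
  have h : smoothTransition =ᶠ[𝓝 x] fun _ ↦ (0 : ℝ) := by
    filter_upwards [Iio_mem_nhds hx] with y hy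
    exact smoothTransition.zero_of_nonpos (le_of_lt hy)
  rw [h.deriv_eq, deriv_const]

/-- `T` is differentiable with derivative `deriv T`. [folklore] -/
theorem hasDerivAt_smoothTransition (x : ℝ) :
    HasDerivAt smoothTransition (deriv smoothTransition x) x :=
  ((smoothTransition.contDiff (n := 1)).differentiable (by norm_num)).differentiableAt.hasDerivAt

/-- The derivative of `T` is bounded: `|T'| ≤ D` for some `D ≥ 0` (it is continuous and
vanishes off the compact interval `[0, 1]`). [folklore] -/
theorem exists_bound_deriv_smoothTransition :
    ∃ D : ℝ, 0 ≤ D ∧ ∀ x, |deriv smoothTransition x| ≤ D := by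
  have hc : Continuous (deriv smoothTransition) :=
    (smoothTransition.contDiff (n := ⊤)).continuous_deriv (by simp)
  obtain ⟨C, hC⟩ := (isCompact_Icc (a := (0 : ℝ)) (b := 1)).exists_bound_of_continuousOn
    hc.continuousOn
  refine ⟨max C 0, le_max_right _ _, fun x ↦ ?_⟩
  by_cases h0 : x < 0
  · rw [deriv_smoothTransition_of_neg h0, abs_zero]; exact le_max_right _ _
  by_cases h1 : 1 < x
  · rw [deriv_smoothTransition_of_one_lt h1, abs_zero]; exact le_max_right _ _
  · have := hC x ⟨not_lt.mp h0, not_lt.mp h1⟩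
    rw [Real.norm_eq_abs] at this
    exact this.trans (le_max_left _ _)

/-! ## The cutoff `cut(s) = T(s/(2ε²) - 1) · T(3 - 4s/r'²)` -/

/-- `0 ≤ cut ≤ 1`. [folklore] -/
theorem cut_mem_Icc (ε r' s : ℝ) :
    0 ≤ smoothTransition (s / (2 * ε ^ 2) - 1) * smoothTransition (3 - 4 * s / r' ^ 2) ∧
      smoothTransition (s / (2 * ε ^ 2) - 1) * smoothTransition (3 - 4 * s / r' ^ 2) ≤ 1 :=
  ⟨mul_nonneg (smoothTransition.nonneg _) (smoothTransition.nonneg _),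
    mul_le_one₀ (smoothTransition.le_one _) (smoothTransition.nonneg _)
      (smoothTransition.le_one _)⟩

/-- `cut = 1` on the bulk `4ε² ≤ s ≤ r'²/2`. [folklore] -/
theorem cut_eq_one {ε r' s : ℝ} (hε : 0 < ε) (hr : 0 < r') (h1 : 4 * ε ^ 2 ≤ s)
    (h2 : s ≤ r' ^ 2 / 2) :
    smoothTransition (s / (2 * ε ^ 2) - 1) * smoothTransition (3 - 4 * s / r' ^ 2) = 1 := by
  have hε2 : 0 < 2 * ε ^ 2 := by positivity
  have hr2 : 0 < r' ^ 2 := by positivity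
  have hA : 1 ≤ s / (2 * ε ^ 2) - 1 := by
    rw [le_sub_iff_add_le, le_div_iff₀ hε2]; linarith
  have hB : 1 ≤ 3 - 4 * s / r' ^ 2 := by
    have : 4 * s / r' ^ 2 ≤ 2 := by
      rw [div_le_iff₀ hr2]; linarith [h2]
    linarith
  rw [smoothTransition.one_of_one_le hA, smoothTransition.one_of_one_le hB, one_mul]

/-- `cut = 0` for `s ≤ 2ε²`. [folklore] -/
theorem cut_eq_zero_of_le {ε r' s : ℝ} (hε : 0 < ε) (h : s ≤ 2 * ε ^ 2) :
    smoothTransition (s / (2 * ε ^ 2) - 1) * smoothTransition (3 - 4 * s / r' ^ 2) = 0 := by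
  have hε2 : 0 < 2 * ε ^ 2 := by positivity
  rw [smoothTransition.zero_of_nonpos, zero_mul]
  rw [sub_nonpos, div_le_one hε2]; exact h

/-- `cut = 0` for `3r'²/4 ≤ s`. [folklore] -/
theorem cut_eq_zero_of_ge {ε r' s : ℝ} (hr : 0 < r') (h : 3 * r' ^ 2 / 4 ≤ s) :
    smoothTransition (s / (2 * ε ^ 2) - 1) * smoothTransition (3 - 4 * s / r' ^ 2) = 0 := by
  have hr2 : 0 < r' ^ 2 := by positivity
  rw [smoothTransition.zero_of_nonpos (x := 3 - 4 * s / r' ^ 2), mul_zero]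
  rw [sub_nonpos, le_div_iff₀ hr2]; linarith

/-! ## The profile `w(s) = e^{-s/8τ} cut(s)` and its derivative -/

/-- The derivative of the profile `w(s) = e^{-s/8τ} · T(s/(2ε²) - 1) · T(3 - 4s/r'²)`
(product and chain rules). [folklore] -/
theorem hasDerivAt_profile (τ ε r' s : ℝ) :
    HasDerivAt (fun s : ℝ ↦ exp (-s / (8 * τ)) *
        (smoothTransition (s / (2 * ε ^ 2) - 1) * smoothTransition (3 - 4 * s / r' ^ 2)))
      (exp (-s / (8 * τ)) * (-1 / (8 * τ)) *
          (smoothTransition (s / (2 * ε ^ 2) - 1) * smoothTransition (3 - 4 * s / r' ^ 2)) +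
        exp (-s / (8 * τ)) *
          (deriv smoothTransition (s / (2 * ε ^ 2) - 1) * (1 / (2 * ε ^ 2)) *
              smoothTransition (3 - 4 * s / r' ^ 2) +
            smoothTransition (s / (2 * ε ^ 2) - 1) *
              (deriv smoothTransition (3 - 4 * s / r' ^ 2) * (-4 / r' ^ 2)))) s := by
  have h1 : HasDerivAt (fun s : ℝ ↦ exp (-s / (8 * τ))) (exp (-s / (8 * τ)) * (-1 / (8 * τ))) s :=
    (((hasDerivAt_id s).neg).div_const (8 * τ)).exp
  have h2 : HasDerivAt (fun s : ℝ ↦ smoothTransition (s / (2 * ε ^ 2) - 1))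
      (deriv smoothTransition (s / (2 * ε ^ 2) - 1) * (1 / (2 * ε ^ 2))) s := by
    have hi : HasDerivAt (fun s : ℝ ↦ s / (2 * ε ^ 2) - 1) (1 / (2 * ε ^ 2)) s :=
      ((hasDerivAt_id s).div_const (2 * ε ^ 2)).sub_const 1
    exact (hasDerivAt_smoothTransition _).comp s hi
  have h3 : HasDerivAt (fun s : ℝ ↦ smoothTransition (3 - 4 * s / r' ^ 2))
      (deriv smoothTransition (3 - 4 * s / r' ^ 2) * (-4 / r' ^ 2)) s := by
    have hi : HasDerivAt (fun s : ℝ ↦ 3 - 4 * s / r' ^ 2) (-4 / r' ^ 2) s := by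
      have := (((hasDerivAt_id s).const_mul 4).div_const (r' ^ 2)).const_sub 3
      exact this.congr_deriv (by simp [neg_div])
    exact (hasDerivAt_smoothTransition _).comp s hi
  exact h1.mul (h2.mul h3)

/-! ## Elementary exponential inequalities -/

/-- `h · s e^{-as} ≤ e^{-(a-h)s} - e^{-as}` (convexity: `1 + hs ≤ e^{hs}`). [folklore] -/
theorem mul_mul_exp_neg_le_sub (a h s : ℝ) :
    h * (s * exp (-a * s)) ≤ exp (-(a - h) * s) - exp (-a * s) := by
  have h1 : h * s + 1 ≤ exp (h * s) := add_one_le_exp _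
  have h2 : exp (-(a - h) * s) = exp (-a * s) * exp (h * s) := by
    rw [← exp_add]; ring_nf
  rw [h2]
  nlinarith [exp_pos (-a * s)]

/-- `uⁿ e^{-u} ≤ n!` for `u ≥ 0`. [folklore] -/
theorem pow_mul_exp_neg_le_factorial {u : ℝ} (hu : 0 ≤ u) (n : ℕ) :
    u ^ n * exp (-u) ≤ n.factorial := by
  have h := pow_div_factorial_le_exp u hu n
  have hn : (0 : ℝ) < n.factorial := by exact_mod_cast n.factorial_pos
  rw [div_le_iff₀ hn] at h
  rw [exp_neg, ← div_eq_mul_inv, div_le_iff₀ (exp_pos u)]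
  linarith

/-- `e^{-R/(16τ)} ≤ 16τ/R` for `R, τ > 0`. [folklore] -/
theorem exp_neg_div_sixteen_le {R τ : ℝ} (hR : 0 < R) (hτ : 0 < τ) :
    exp (-R / (16 * τ)) ≤ 16 * τ / R := by
  have hu : 0 < R / (16 * τ) := by positivity
  have h16 : (0 : ℝ) < 16 * τ := by positivity
  have h := pow_mul_exp_neg_le_factorial hu.le 1
  simp only [pow_one, Nat.factorial_one, Nat.cast_one] at h
  have e1 : -R / (16 * τ) = -(R / (16 * τ)) := by ring
  have key : R * exp (-(R / (16 * τ))) ≤ 16 * τ := by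
    have := mul_le_mul_of_nonneg_right h h16.le
    calc R * exp (-(R / (16 * τ))) = R / (16 * τ) * exp (-(R / (16 * τ))) * (16 * τ) := by
          field_simp
      _ ≤ 1 * (16 * τ) := this
      _ = 16 * τ := one_mul _
  rw [e1, le_div_iff₀ hR]
  linarith [key]

/-- `R · e^{-R/(8τ)} ≤ 128 τ²/R` for `R, τ > 0` (from `u² e^{-u} ≤ 2`). [folklore] -/
theorem mul_exp_neg_div_eight_le {R τ : ℝ} (hR : 0 < R) (hτ : 0 < τ) :
    R * exp (-R / (8 * τ)) ≤ 128 * τ ^ 2 / R := by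
  have hu : 0 < R / (8 * τ) := by positivity
  have h8 : (0 : ℝ) < 8 * τ := by positivity
  have h := pow_mul_exp_neg_le_factorial hu.le 2
  simp only [Nat.factorial_two, Nat.cast_ofNat] at h
  have e1 : -R / (8 * τ) = -(R / (8 * τ)) := by ring
  rw [e1, le_div_iff₀ hR]
  have e2 : R * exp (-(R / (8 * τ))) * R = (R / (8 * τ)) ^ 2 * exp (-(R / (8 * τ))) * (64 * τ ^ 2) := by
    field_simp
    ring
  rw [e2]
  nlinarith [h, sq_nonneg τ]

/-- `R³ · e^{-R/(8τ)} ≤ 98304 τ⁴/R` for `R, τ > 0` (from `u⁴ e^{-u} ≤ 24`). [folklore] -/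
theorem pow_three_mul_exp_neg_div_eight_le {R τ : ℝ} (hR : 0 < R) (hτ : 0 < τ) :
    R ^ 3 * exp (-R / (8 * τ)) ≤ 98304 * τ ^ 4 / R := by
  have hu : 0 < R / (8 * τ) := by positivity
  have h8 : (0 : ℝ) < 8 * τ := by positivity
  have h := pow_mul_exp_neg_le_factorial hu.le 4
  have h24 : ((Nat.factorial 4 : ℕ) : ℝ) = 24 := by norm_num [Nat.factorial]
  rw [h24] at h
  have e1 : -R / (8 * τ) = -(R / (8 * τ)) := by ring
  rw [e1, le_div_iff₀ hR]
  have e2 : R ^ 3 * exp (-(R / (8 * τ))) * R =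
      (R / (8 * τ)) ^ 4 * exp (-(R / (8 * τ))) * (4096 * τ ^ 4) := by
    field_simp
    ring
  rw [e2]
  nlinarith [h, pow_pos hτ 4]

/-! ## Pointwise bounds for the profile -/

/-- `e^{-s/8τ}² = e^{-s/4τ}`. [folklore] -/
theorem exp_neg_div_eight_sq (τ s : ℝ) : exp (-s / (8 * τ)) ^ 2 = exp (-s / (4 * τ)) := by
  rw [← exp_nat_mul]; congr 1; push_cast; ring

/-- The transition shells: `e^{-s/4τ} (1 - cut²) ≤ e · e^{-s/(4ε²)} + e^{-r'²/16τ} e^{-s/8τ}`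
(the left side vanishes on the bulk `4ε² ≤ s ≤ r'²/2`; below it the first Gaussian is `≥ 1`,
above it `e^{-s/4τ} ≤ e^{-r'²/16τ} e^{-s/8τ}`). [folklore] -/
theorem shell_le {τ ε r' s : ℝ} (hτ : 0 < τ) (hε : 0 < ε) (hr : 0 < r') (hs : 0 ≤ s) :
    exp (-s / (4 * τ)) *
        (1 - (smoothTransition (s / (2 * ε ^ 2) - 1) * smoothTransition (3 - 4 * s / r' ^ 2)) ^ 2) ≤
      exp 1 * exp (-s / (4 * ε ^ 2)) + exp (-r' ^ 2 / (16 * τ)) * exp (-s / (8 * τ)) := by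
  obtain ⟨hc0, hc1⟩ := cut_mem_Icc ε r' s
  set C := smoothTransition (s / (2 * ε ^ 2) - 1) * smoothTransition (3 - 4 * s / r' ^ 2) with hC
  have hE1 : exp (-s / (4 * τ)) ≤ 1 := by
    rw [exp_le_one_iff, div_nonpos_iff]; right; constructor <;> nlinarith
  have h1C : 1 - C ^ 2 ≤ 1 := by nlinarith
  have h0C : 0 ≤ 1 - C ^ 2 := by nlinarith
  have hA : 0 ≤ exp 1 * exp (-s / (4 * ε ^ 2)) := by positivity
  have hB : 0 ≤ exp (-r' ^ 2 / (16 * τ)) * exp (-s / (8 * τ)) := by positivity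
  rcases lt_or_ge s (4 * ε ^ 2) with h1 | h1
  · -- inner shell: the first Gaussian is ≥ 1
    have hG : 1 ≤ exp 1 * exp (-s / (4 * ε ^ 2)) := by
      rw [← exp_add]
      apply one_le_exp
      have : s / (4 * ε ^ 2) ≤ 1 := by
        rw [div_le_one (by positivity)]; exact h1.le
      have e : -s / (4 * ε ^ 2) = -(s / (4 * ε ^ 2)) := by ring
      rw [e]; linarith
    have := mul_le_mul hE1 h1C h0C zero_le_one
    linarith
  rcases lt_or_ge (r' ^ 2 / 2) s with h2 | h2
  · -- outer shell: `e^{-s/4τ} ≤ e^{-r'²/16τ} e^{-s/8τ}`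
    have hG : exp (-s / (4 * τ)) ≤ exp (-r' ^ 2 / (16 * τ)) * exp (-s / (8 * τ)) := by
      rw [← exp_add, exp_le_exp]
      have e : -r' ^ 2 / (16 * τ) + -s / (8 * τ) - -s / (4 * τ) = (2 * s - r' ^ 2) / (16 * τ) := by
        field_simp
        ring
      have : 0 ≤ (2 * s - r' ^ 2) / (16 * τ) := div_nonneg (by linarith) (by positivity)
      linarith
    have := mul_le_mul hG h1C h0C hB
    linarith
  · -- bulk: `cut = 1`
    have hC1 : C = 1 := cut_eq_one hε hr h1 h2
    rw [hC1]
    simp only [one_pow, sub_self, mul_zero]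
    positivity

/-- Upper bound `w² ≤ e^{-s/4τ}`. [folklore] -/
theorem profile_sq_le (τ ε r' s : ℝ) :
    (exp (-s / (8 * τ)) *
        (smoothTransition (s / (2 * ε ^ 2) - 1) * smoothTransition (3 - 4 * s / r' ^ 2))) ^ 2 ≤
      exp (-s / (4 * τ)) := by
  obtain ⟨hc0, hc1⟩ := cut_mem_Icc ε r' s
  rw [mul_pow, exp_neg_div_eight_sq]
  have := exp_pos (-s / (4 * τ))
  have hsq : (smoothTransition (s / (2 * ε ^ 2) - 1) * smoothTransition (3 - 4 * s / r' ^ 2)) ^ 2 ≤ 1 := by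
    nlinarith
  nlinarith

/-- Lower bound `e^{-s/4τ} - e · e^{-s/(4ε²)} - e^{-r'²/16τ} e^{-s/8τ} ≤ w²`. [folklore] -/
theorem profile_sq_ge {τ ε r' s : ℝ} (hτ : 0 < τ) (hε : 0 < ε) (hr : 0 < r') (hs : 0 ≤ s) :
    exp (-s / (4 * τ)) - exp 1 * exp (-s / (4 * ε ^ 2)) -
        exp (-r' ^ 2 / (16 * τ)) * exp (-s / (8 * τ)) ≤
      (exp (-s / (8 * τ)) *
        (smoothTransition (s / (2 * ε ^ 2) - 1) * smoothTransition (3 - 4 * s / r' ^ 2))) ^ 2 := by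
  have h := shell_le hτ hε hr hs
  rw [mul_pow, exp_neg_div_eight_sq]
  nlinarith [h]

/-- Entropy density bound `-w² log w² ≤ (s/4τ) e^{-s/4τ} + e · e^{-s/(4ε²)} + e^{-r'²/16τ} e^{-s/8τ}`
(`-u log u ≤ 1 - u` for the cutoff factor `u = cut² ∈ (0, 1]`). [folklore] -/
theorem negMulLog_profile_sq_le {τ ε r' s : ℝ} (hτ : 0 < τ) (hε : 0 < ε) (hr : 0 < r')
    (hs : 0 ≤ s) :
    -((exp (-s / (8 * τ)) *
          (smoothTransition (s / (2 * ε ^ 2) - 1) * smoothTransition (3 - 4 * s / r' ^ 2))) ^ 2 *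
        log ((exp (-s / (8 * τ)) *
          (smoothTransition (s / (2 * ε ^ 2) - 1) * smoothTransition (3 - 4 * s / r' ^ 2))) ^ 2)) ≤
      s / (4 * τ) * exp (-s / (4 * τ)) + exp 1 * exp (-s / (4 * ε ^ 2)) +
        exp (-r' ^ 2 / (16 * τ)) * exp (-s / (8 * τ)) := by
  have hsh := shell_le hτ hε hr hs
  obtain ⟨hc0, hc1⟩ := cut_mem_Icc ε r' s
  set C := smoothTransition (s / (2 * ε ^ 2) - 1) * smoothTransition (3 - 4 * s / r' ^ 2) with hC
  have hE := exp_pos (-s / (4 * τ))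
  have hmain : 0 ≤ s / (4 * τ) * exp (-s / (4 * τ)) := by positivity
  rcases hc0.eq_or_lt with h0 | hpos
  · have hW : (exp (-s / (8 * τ)) * C) ^ 2 = 0 := by rw [← h0]; simp
    rw [hW]
    simp only [log_zero, mul_zero, neg_zero]
    positivity
  · have hC2 : 0 < C ^ 2 := by positivity
    have hlog : log ((exp (-s / (8 * τ)) * C) ^ 2) = -s / (4 * τ) + log (C ^ 2) := by
      rw [mul_pow, exp_neg_div_eight_sq, log_mul (exp_pos _).ne' hC2.ne', log_exp]
    have hul : -(C ^ 2 * log (C ^ 2)) ≤ 1 - C ^ 2 := by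
      have := one_sub_inv_le_log_of_pos hC2
      have h' : C ^ 2 * (1 - (C ^ 2)⁻¹) ≤ C ^ 2 * log (C ^ 2) := mul_le_mul_of_nonneg_left this hC2.le
      rw [mul_sub, mul_inv_cancel₀ hC2.ne', mul_one] at h'
      linarith
    rw [hlog, mul_pow, exp_neg_div_eight_sq]
    have : -(exp (-s / (4 * τ)) * C ^ 2 * (-s / (4 * τ) + log (C ^ 2))) =
        s / (4 * τ) * exp (-s / (4 * τ)) * C ^ 2 + exp (-s / (4 * τ)) * -(C ^ 2 * log (C ^ 2)) := by
      ring
    rw [this]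
    have hsq : C ^ 2 ≤ 1 := by nlinarith
    nlinarith [mul_le_mul_of_nonneg_left hul hE.le, mul_le_mul_of_nonneg_left hsq hmain]

/-- The profile vanishes for `s ≤ 2ε²`. [folklore] -/
theorem profile_eq_zero_of_le {τ ε r' s : ℝ} (hε : 0 < ε) (h : s ≤ 2 * ε ^ 2) :
    exp (-s / (8 * τ)) *
        (smoothTransition (s / (2 * ε ^ 2) - 1) * smoothTransition (3 - 4 * s / r' ^ 2)) = 0 := by
  rw [cut_eq_zero_of_le hε h, mul_zero]

/-- The profile vanishes for `3r'²/4 ≤ s`. [folklore] -/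
theorem profile_eq_zero_of_ge {τ ε r' s : ℝ} (hr : 0 < r') (h : 3 * r' ^ 2 / 4 ≤ s) :
    exp (-s / (8 * τ)) *
        (smoothTransition (s / (2 * ε ^ 2) - 1) * smoothTransition (3 - 4 * s / r' ^ 2)) = 0 := by
  rw [cut_eq_zero_of_ge hr h, mul_zero]

/-- The profile is continuous in `s`. [folklore] -/
theorem continuous_profile (τ ε r' : ℝ) :
    Continuous (fun s : ℝ ↦ exp (-s / (8 * τ)) *
        (smoothTransition (s / (2 * ε ^ 2) - 1) * smoothTransition (3 - 4 * s / r' ^ 2))) := by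
  refine Continuous.mul (by fun_prop) (Continuous.mul ?_ ?_)
  · exact smoothTransition.continuous.comp (by fun_prop)
  · exact smoothTransition.continuous.comp (by fun_prop)

end ConeAnnulus

/-- **Registered sub-goal `stub_coneAnnulusPointwise`** of `stub_coneAnnulusArithmetic`: the pointwise
two-sided Gaussian bound for `w²` and the entropy-density bound for `-w² log w²`. [folklore] -/
theorem stub_coneAnnulusPointwise :
    ∀ (τ ε r' s : ℝ), 0 < τ → 0 < ε → 0 < r' → 0 ≤ s →
      Real.exp (-s / (4 * τ)) - Real.exp 1 * Real.exp (-s / (4 * ε ^ 2)) -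
            Real.exp (-r' ^ 2 / (16 * τ)) * Real.exp (-s / (8 * τ)) ≤
          (Real.exp (-s / (8 * τ)) * (Real.smoothTransition (s / (2 * ε ^ 2) - 1) *
            Real.smoothTransition (3 - 4 * s / r' ^ 2))) ^ 2 ∧
        (Real.exp (-s / (8 * τ)) * (Real.smoothTransition (s / (2 * ε ^ 2) - 1) *
            Real.smoothTransition (3 - 4 * s / r' ^ 2))) ^ 2 ≤ Real.exp (-s / (4 * τ)) ∧
        -((Real.exp (-s / (8 * τ)) * (Real.smoothTransition (s / (2 * ε ^ 2) - 1) *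
              Real.smoothTransition (3 - 4 * s / r' ^ 2))) ^ 2 *
            Real.log ((Real.exp (-s / (8 * τ)) * (Real.smoothTransition (s / (2 * ε ^ 2) - 1) *
              Real.smoothTransition (3 - 4 * s / r' ^ 2))) ^ 2)) ≤
          s / (4 * τ) * Real.exp (-s / (4 * τ)) + Real.exp 1 * Real.exp (-s / (4 * ε ^ 2)) +
            Real.exp (-r' ^ 2 / (16 * τ)) * Real.exp (-s / (8 * τ)) :=
  fun τ ε r' s hτ hε hr hs ↦
    ⟨ConeAnnulus.profile_sq_ge hτ hε hr hs, ConeAnnulus.profile_sq_le τ ε r' s,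
      ConeAnnulus.negMulLog_profile_sq_le hτ hε hr hs⟩

end Summit.SmoothPoincare4.SmoothPoincare4.Theorems.SubcylindricalRecognition.AncientSphereRigidity
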